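import Summits.CriticalPhenomena.PercolationContinuityZ3.Theorems.Transplant.FKConnectivityAllQAntipodalAndPlus
import HarnessLib

/-!
# Connectivity correlation inequalities for `φ_{w,q}`, every `q > 0` — file 32eW: the `q`-free (level) form of `C_∞` for the OR type — every edge
# set, every cell (the odd increments of `⋁_{e∈S} ω_e` and `⋀_{e∈S} ω_e` coincide termwise)

Support file (`--supports stmt-CriticalPhenomena-4575`), FK sub-lane `prim-bschramm-fk-2` (gen 21); builds on p205010 (kernel theorem,
internal audit signed; external expert review pending).  No definitions, no named facts, no sorries; standard axioms.

`FK.orInd_odd_eq_andInd_odd`: for `S` nonempty, disjoint from `C`, and a complementary pair `(γ, γᶜ)` of `N ∪ S`: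
`1{S ∩ (γ∪C) ≠ ∅} − 1{S ∩ (γᶜ∪C) ≠ ∅} = 1{S ⊆ γ∪C} − 1{S ⊆ γᶜ∪C}`.  Hence (**`FK.apPsiC_levels_le_or_nonpos_of_isTTSP`**) the level partial sums of
the antipodal form of `⋁_{e∈S} ω_e` against an increasing `g` off `S` are those of `⋀_{e∈S} ω_e`, `≤ 0` by `…AntipodalAndPlus`: every coefficient in
`(z, q)` of `Z_H² Cov_{φ_{z,q}}(⋁_{e∈S} ω_e, g)/(q−1)` is nonnegative on series–parallel graphs — Conjecture C_∞⁺ (FK-Q2 §30) for the OR type.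
[cite: Grimmett2006, §3.8 Thm. (3.90) (pp. 61–62); §3.9 (pp. 63–64)] [cite: Wagner2006, Thm. 5.8(d), §5.3]
-/

noncomputable section

namespace Summit.CriticalPhenomena.PercolationContinuityZ3.Theorems

namespace FK

open SimpleGraph Literature.Probability.LatticeModels Literature.Probability.Percolation
open scoped Classical

variable {V : Type*} [Fintype V]

section AndPlusOr

omit [Fintype V] in
/-- **OR and AND have the same odd increments along complementary pairs.**  `S` nonempty, `S ∩ C = ∅`, any `γ`:
`1{(S ∩ (γ ∪ C)).Nonempty} − 1{(S ∩ ((N∪S)\γ ∪ C)).Nonempty} = 1{S ⊆ γ ∪ C} − 1{S ⊆ (N∪S)\γ ∪ C}`. [folklore] -/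
theorem orInd_odd_eq_andInd_odd {N S C γ : Finset (Sym2 V)} (hS : S.Nonempty) (hSC : Disjoint S C) :
    ((if (S ∩ (γ ∪ C)).Nonempty then (1 : ℝ) else 0) - (if (S ∩ ((N ∪ S) \ γ ∪ C)).Nonempty then 1 else 0)) =
      ((if S ⊆ γ ∪ C then (1 : ℝ) else 0) - (if S ⊆ (N ∪ S) \ γ ∪ C then 1 else 0)) := by
  -- membership of an `S`-edge in `γ ∪ C` resp. in the complement side
  have memL : ∀ e ∈ S, (e ∈ γ ∪ C ↔ e ∈ γ) := fun e he => by
    rw [Finset.mem_union, or_iff_left (fun h => Finset.disjoint_left.1 hSC he h)]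
  have memR : ∀ e ∈ S, (e ∈ (N ∪ S) \ γ ∪ C ↔ e ∉ γ) := fun e he => by
    rw [Finset.mem_union, or_iff_left (fun h => Finset.disjoint_left.1 hSC he h), Finset.mem_sdiff]
    exact ⟨fun h => h.2, fun h => ⟨Finset.mem_union_right _ he, h⟩⟩
  by_cases hall : S ⊆ γ ∪ C
  · -- every `S`-edge lies in `γ`
    have hall' : ∀ e ∈ S, e ∈ γ := fun e he => (memL e he).1 (hall he)
    have n1 : (S ∩ (γ ∪ C)).Nonempty := by
      obtain ⟨e, he⟩ := hS; exact ⟨e, Finset.mem_inter.2 ⟨he, hall he⟩⟩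
    have n2 : ¬ (S ∩ ((N ∪ S) \ γ ∪ C)).Nonempty := by
      rintro ⟨e, he⟩
      have he' := Finset.mem_inter.1 he
      exact (memR e he'.1).1 he'.2 (hall' e he'.1)
    have n3 : ¬ S ⊆ (N ∪ S) \ γ ∪ C := by
      intro h; obtain ⟨e, he⟩ := hS; exact (memR e he).1 (h he) (hall' e he)
    rw [if_pos n1, if_neg n2, if_pos hall, if_neg n3]
  · by_cases hnone : S ⊆ (N ∪ S) \ γ ∪ C
    · have hnone' : ∀ e ∈ S, e ∉ γ := fun e he => (memR e he).1 (hnone he)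
      have n1 : ¬ (S ∩ (γ ∪ C)).Nonempty := by
        rintro ⟨e, he⟩
        have he' := Finset.mem_inter.1 he
        exact hnone' e he'.1 ((memL e he'.1).1 he'.2)
      have n2 : (S ∩ ((N ∪ S) \ γ ∪ C)).Nonempty := by
        obtain ⟨e, he⟩ := hS; exact ⟨e, Finset.mem_inter.2 ⟨he, hnone he⟩⟩
      rw [if_neg n1, if_pos n2, if_neg hall, if_pos hnone]
    · -- partial: some `S`-edge in `γ`, some not
      have n1 : (S ∩ (γ ∪ C)).Nonempty := by
        by_contra h
        apply hnone
        intro e he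
        rw [memR e he]
        intro heγ
        exact h ⟨e, Finset.mem_inter.2 ⟨he, (memL e he).2 heγ⟩⟩
      have n2 : (S ∩ ((N ∪ S) \ γ ∪ C)).Nonempty := by
        by_contra h
        apply hall
        intro e he
        rw [memL e he]
        by_contra heγ
        exact h ⟨e, Finset.mem_inter.2 ⟨he, (memR e he).2 heγ⟩⟩
      rw [if_pos n1, if_pos n2, if_neg hall, if_neg hnone]
      norm_num

/-- **Conjecture C_∞⁺ for the OR type (every edge set, every cell).**  Under the hypotheses of `FK.apPsiC_levels_le_and_nonpos_of_isTTSP`, for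
every level cut-off `J`: the level partial sum of the antipodal form of `⋁_{e∈S} ω_e` (`S = T ∪ {st}`) against `g` over the cell `(N ∪ S, C)` is
`≤ 0` — every coefficient in `(z, q)` of `Z_H² Cov_{φ_{z,q}}(⋁_{e∈S} ω_e, g)/(q−1)` is nonnegative.
[cite: Grimmett2006, §3.8 Thm. (3.90) (pp. 61–62); §3.9 (pp. 63–64)] [cite: Wagner2006, Thm. 5.8(d), §5.3] -/
theorem apPsiC_levels_le_or_nonpos_of_isTTSP {E : Finset (Sym2 V)} {s t : V}
    (hE : IsTTSP E s t) (hst : s(s, t) ∉ E) {N T C : Finset (Sym2 V)} (hN : N ⊆ E) (hT : T ⊆ E) (hC : C ⊆ E)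
    (hNT : Disjoint N T) (hNC : Disjoint N C) (hTC : Disjoint T C) (J : ℕ)
    {g : Finset (Sym2 V) → ℝ} (hg : ∀ A U : Finset (Sym2 V), U ⊆ insert s(s, t) T → g (A ∪ U) = g A)
    (hmono : ∀ ⦃X Y : Finset (Sym2 V)⦄, X ⊆ Y → g X ≤ g Y) :
    ∑ γ ∈ (N ∪ insert s(s, t) T).powerset with apExpC (N ∪ insert s(s, t) T) C γ ≤ J,
        ((if (insert s(s, t) T ∩ (γ ∪ C)).Nonempty then (1 : ℝ) else 0) -
            (if (insert s(s, t) T ∩ ((N ∪ insert s(s, t) T) \ γ ∪ C)).Nonempty then 1 else 0)) *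
          (g (γ ∪ C) - g ((N ∪ insert s(s, t) T) \ γ ∪ C)) ≤ 0 := by
  have hSC : Disjoint (insert s(s, t) T) C := Finset.disjoint_insert_left.2 ⟨fun h => hst (hC h), hTC⟩
  have key := apPsiC_levels_le_and_nonpos_of_isTTSP hE hst hN hT hC hNT hNC hTC J hg hmono
  refine le_of_eq_of_le (Finset.sum_congr rfl fun γ _ => ?_) key
  rw [orInd_odd_eq_andInd_odd ⟨s(s, t), Finset.mem_insert_self _ _⟩ hSC]

end AndPlusOr

end FK

end Summit.CriticalPhenomena.PercolationContinuityZ3.Theorems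

end
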